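import Summits.QuantumFields.YangMills.Theorems.LuscherReductionTwistedTraceScalingBTOffDiagonalBound
import HarnessLib

/-!
# (L2) NEAR PAIRS, integrated: `e^{−η}·f(u,u) ≤ f(u,u') ≤ e^{η}·f(u,u)` with the explicit `η` of `abs_offX_le`
# (lane A of S-BASE, crux `TwistedTraceScaling` stmt-QuantumFields-20203, C4-CORE, the (B-T) pen; design note `pub/ym-fleet/ym-luscher-20007-p1/COARSE-DESIGN.md` §25.6 (L2), §25.7)

* ★★★ `fpBOKernel_offdiag_two_sided_cap` — the a.e.-cap form of `fpBOKernel_offdiag_two_sided`: the hypothesis `|offX| ≤ η` is needed only at BALANCED capped fibre points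
  (`orthoTransverse` is carried by `capBalancedSet`), where the tube identities hold;
* ★★★ `fpBOKernel_near_two_sided` — for `Ω, W ≥ 0` with `supp Ω ⊂ {|v_{e,c}| ≤ t, ‖v̂‖ ≤ R}` and `supp W ⊂ {g⁰_x ≥ 0, Σ_c g⃗²_{x,c} ≤ t², ‖Σ_x g⃗_x‖ ≤ Γ}` (the core of the
  Faddeev–Popov slab) and a NEAR pair `w_k = u_ku'_k⁻¹`, `|a⃗_{k,c}| ≤ α ≤ 1`, `w⁰_k ≥ 0`, `‖u⃗_k‖ ≤ τ_u`, `L³S₁(u), L³S₁(u') ≤ σ < 2`: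
  `f(u,u')/f(u,u) ∈ [e^{−η}, e^{η}]`, `η = β(|E|(558α²t² + 192αt²) + 216ατ_uΓ) + (β/2)(100σNR² + 2E(t,σ) + 10080αNR²)`, `f = fpBOKernel/K₁^{(L³β)}`.
With the sizes of record (`t = R ≍ β^{-1/2}log β`, `α ≤ B^{-1/2}log β`, `Γ ≤ β^{-1}|Λ|`, `σ ≍ β^{-2s}`, `τ_u ≍ β^{-s}`) `η = O(β^{-1/2}log³β) → 0`, far inside the (B-T) rate.
Together with `fpBOKernel_diag_two_sided` ((L3)) this is the whole NEAR-PAIR comparison `fpBOKernel(u,u') = C·K₁(u,u')(1 ± κ)`; (L1) (far pairs, tails, floor) and the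
assembly through `hT_of_fp_add` remain.
HONEST FRAMING: monotone integration for a stub of a child of the CONDITIONAL reduction route R2b1; C4-CORE OPEN; not infinite volume, not a gap, not Clay.
-/

set_option autoImplicit false

noncomputable section

open MeasureTheory Filter Topology Real
open scoped BigOperators Matrix InnerProductSpace RealInnerProductSpace
open Literature.MathematicalPhysics.QuantumFieldTheory
open Literature.MathematicalPhysics.QuantumLattice

namespace Summit.QuantumFields.YangMills.Theorems.FemtoTransferGap.TwoLattice.ConstTube

open Summit.QuantumFields.YangMills.Theorems.FemtoTransferGap
open Summit.QuantumFields.YangMills.Theorems.FemtoTransferGap.TwoLattice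
open Summit.QuantumFields.YangMills.Theorems.FemtoTransferGap.TwoLattice.Avg
open Summit.QuantumFields.YangMills.Theorems.FemtoTransferGap.TwoLattice.Stiff
open Summit.QuantumFields.YangMills.Theorems.FemtoTransferGap.TwoLattice.Cov
open Summit.QuantumFields.YangMills.Theorems.FemtoTransferGap.TwoLattice.Toron

variable {L : ℕ} [NeZero L]

/-- ★★★ **(L2), integrated, a.e.-cap form**: for `Ω, W ≥ 0` bounded measurable, if `|offX β u u' v v' g| ≤ η` whenever `v, v' ∈ capBalancedSet`, `Ω(v), Ω(v'), W(g) ≠ 0`,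
then `e^{−η}·f(u,u) ≤ f(u,u') ≤ e^{η}·f(u,u)`, `f(u,u') = fpBOKernel β Ω W u u' / K₁^{(L³β)}(u,u')` (the fibre law is carried by the balanced cap). [cite: Luscher1983, §3] -/
theorem fpBOKernel_offdiag_two_sided_cap (β : ℝ) {Ω : LinkSpace L → ℝ} (hΩm : Measurable Ω) {CΩ : ℝ} (hCΩ : ∀ x, |Ω x| ≤ CΩ) (hΩ0 : ∀ x, 0 ≤ Ω x)
    {W : (Site 3 L → SU2) → ℝ} (hW : Measurable W) {CW : ℝ} (hCW : ∀ g, |W g| ≤ CW) (hW0 : ∀ g, 0 ≤ W g) (u u' : GaugeConfig 3 1 SU2) {η : ℝ}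
    (hη : ∀ (v v' : Edge 3 L → Fin 3 → ℝ) (g : Site 3 L → SU2), v ∈ capBalancedSet L → v' ∈ capBalancedSet L →
      Ω (linkEmbed L v) ≠ 0 → Ω (linkEmbed L v') ≠ 0 → W g ≠ 0 → |offX L β u u' v v' g| ≤ η) :
    Real.exp (-η) * (fpBOKernel L β Ω W u u / transferKernel su2Rep ((L : ℝ) ^ 3 * β) u u) ≤ fpBOKernel L β Ω W u u' / transferKernel su2Rep ((L : ℝ) ^ 3 * β) u u' ∧
      fpBOKernel L β Ω W u u' / transferKernel su2Rep ((L : ℝ) ^ 3 * β) u u' ≤ Real.exp η * (fpBOKernel L β Ω W u u / transferKernel su2Rep ((L : ℝ) ^ 3 * β) u u) := by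
  haveI := isFiniteMeasure_orthoTransverse L
  set μP : Measure ((Edge 3 L → Fin 3 → ℝ) × ((Edge 3 L → Fin 3 → ℝ) × (Site 3 L → SU2))) := (orthoTransverse L).prod ((orthoTransverse L).prod (gaugeMeasure L)) with hμP
  haveI : IsFiniteMeasure μP := by rw [hμP]; infer_instance
  have hKd : 0 < transferKernel su2Rep ((L : ℝ) ^ 3 * β) u u := transferKernel_pos _ _ _ _
  have hKo : 0 < transferKernel su2Rep ((L : ℝ) ^ 3 * β) u u' := transferKernel_pos _ _ _ _
  set ρd : ((Edge 3 L → Fin 3 → ℝ) × ((Edge 3 L → Fin 3 → ℝ) × (Site 3 L → SU2))) → ℝ := fun p => fpTriple L β Ω W u u p / transferKernel su2Rep ((L : ℝ) ^ 3 * β) u u with hρd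
  set ρo : ((Edge 3 L → Fin 3 → ℝ) × ((Edge 3 L → Fin 3 → ℝ) × (Site 3 L → SU2))) → ℝ := fun p => fpTriple L β Ω W u u' p / transferKernel su2Rep ((L : ℝ) ^ 3 * β) u u' with hρo
  obtain ⟨Bd, hBd⟩ := abs_fpTriple_le (L := L) β hCΩ hCW u u
  obtain ⟨Bo, hBo⟩ := abs_fpTriple_le (L := L) β hCΩ hCW u u'
  have hρd_int : Integrable ρd μP := integrable_of_measurable_abs_le _ ((measurable_fpTriple β hΩm hW u u).div_const _) (C := Bd / transferKernel su2Rep ((L : ℝ) ^ 3 * β) u u)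
    fun p => by rw [hρd]; dsimp only; rw [abs_div, abs_of_pos hKd]; exact div_le_div_of_nonneg_right (hBd p) hKd.le
  have hρo_int : Integrable ρo μP := integrable_of_measurable_abs_le _ ((measurable_fpTriple β hΩm hW u u').div_const _) (C := Bo / transferKernel su2Rep ((L : ℝ) ^ 3 * β) u u')
    fun p => by rw [hρo]; dsimp only; rw [abs_div, abs_of_pos hKo]; exact div_le_div_of_nonneg_right (hBo p) hKo.le
  have hfd : fpBOKernel L β Ω W u u / transferKernel su2Rep ((L : ℝ) ^ 3 * β) u u = ∫ p, ρd p ∂μP := by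
    rw [hρd, integral_div, hμP, ← fpBOKernel_eq_integral_prod β hΩm hCΩ hW hCW]
  have hfo : fpBOKernel L β Ω W u u' / transferKernel su2Rep ((L : ℝ) ^ 3 * β) u u' = ∫ p, ρo p ∂μP := by
    rw [hρo, integral_div, hμP, ← fpBOKernel_eq_integral_prod β hΩm hCΩ hW hCW]
  have hpt : ∀ p, ρo p = ρd p * Real.exp (offX L β u u' p.1 p.2.1 p.2.2) := fun p => by
    rw [hρo, hρd]; dsimp only; unfold fpTriple
    have h := transferKernel_orthoTube_offdiag_div (L := L) β u u' p.1 p.2.1 p.2.2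
    calc Ω (linkEmbed L p.1) * (W p.2.2 * transferKernel su2Rep β (orthoTube L u p.1) (gaugeTransform p.2.2 (orthoTube L u' p.2.1)) * Ω (linkEmbed L p.2.1)) /
          transferKernel su2Rep ((L : ℝ) ^ 3 * β) u u'
        = Ω (linkEmbed L p.1) * (W p.2.2 * Ω (linkEmbed L p.2.1)) *
            (transferKernel su2Rep β (orthoTube L u p.1) (gaugeTransform p.2.2 (orthoTube L u' p.2.1)) / transferKernel su2Rep ((L : ℝ) ^ 3 * β) u u') := by ring
      _ = Ω (linkEmbed L p.1) * (W p.2.2 * Ω (linkEmbed L p.2.1)) *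
            (transferKernel su2Rep β (orthoTube L u p.1) (gaugeTransform p.2.2 (orthoTube L u p.2.1)) / transferKernel su2Rep ((L : ℝ) ^ 3 * β) u u *
              Real.exp (offX L β u u' p.1 p.2.1 p.2.2)) := by rw [h]
      _ = _ := by ring
  have hρd0 : ∀ p, 0 ≤ ρd p := fun p => by
    rw [hρd]; dsimp only; unfold fpTriple
    exact div_nonneg (mul_nonneg (hΩ0 _) (mul_nonneg (mul_nonneg (hW0 _) (transferKernel_pos _ _ _ _).le) (hΩ0 _))) hKd.le
  -- the caps hold almost everywhere
  have hcapπ : ∀ᵐ v ∂orthoTransverse L, v ∈ capBalancedSet L := by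
    rw [ae_iff]; have h0 := orthoTransverse_compl_capBalancedSet L; simpa only [Set.compl_def] using h0
  have hcap1 : ∀ᵐ p ∂μP, p.1 ∈ capBalancedSet L := by
    rw [hμP]; exact (Measure.quasiMeasurePreserving_fst (μ := orthoTransverse L) (ν := (orthoTransverse L).prod (gaugeMeasure L))).ae hcapπ
  have hcap2 : ∀ᵐ p ∂μP, p.2.1 ∈ capBalancedSet L := by
    rw [hμP]
    have h2 : ∀ᵐ q ∂((orthoTransverse L).prod (gaugeMeasure L)), q.1 ∈ capBalancedSet L :=
      (Measure.quasiMeasurePreserving_fst (μ := orthoTransverse L) (ν := gaugeMeasure L)).ae hcapπ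
    exact (Measure.quasiMeasurePreserving_snd (μ := orthoTransverse L) (ν := (orthoTransverse L).prod (gaugeMeasure L))).ae h2
  have hbounds : ∀ᵐ p ∂μP, Real.exp (-η) * ρd p ≤ ρo p ∧ ρo p ≤ Real.exp η * ρd p := by
    filter_upwards [hcap1, hcap2] with p hv hv'
    rw [hpt p]
    by_cases h0 : ρd p = 0
    · rw [h0]; simp
    · have hne : fpTriple L β Ω W u u p ≠ 0 := by intro hz; apply h0; rw [hρd]; dsimp only; rw [hz, zero_div]
      have hΩv : Ω (linkEmbed L p.1) ≠ 0 := by intro hz; apply hne; unfold fpTriple; rw [hz, zero_mul]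
      have hΩv' : Ω (linkEmbed L p.2.1) ≠ 0 := by intro hz; apply hne; unfold fpTriple; rw [hz, mul_zero, mul_zero]
      have hWg : W p.2.2 ≠ 0 := by intro hz; apply hne; unfold fpTriple; rw [hz, zero_mul, zero_mul, mul_zero]
      have hX := abs_le.mp (hη p.1 p.2.1 p.2.2 hv hv' hΩv hΩv' hWg)
      have hp0 := hρd0 p
      constructor
      · rw [mul_comm]; exact mul_le_mul_of_nonneg_left (Real.exp_le_exp.mpr hX.1) hp0
      · rw [mul_comm (Real.exp η)]; exact mul_le_mul_of_nonneg_left (Real.exp_le_exp.mpr hX.2) hp0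
  rw [hfd, hfo, ← integral_const_mul, ← integral_const_mul]
  exact ⟨integral_mono_ae (hρd_int.const_mul _) hρo_int (hbounds.mono fun p hp => hp.1),
    integral_mono_ae hρo_int (hρd_int.const_mul _) (hbounds.mono fun p hp => hp.2)⟩


/-- ★★★ **THE NEAR-PAIR COMPARISON** on the core of the Faddeev–Popov slab: `e^{−η}·f(u,u) ≤ f(u,u') ≤ e^{η}·f(u,u)` with the explicit `η` of `abs_offX_le`
(`‖v̂'‖ ≤ R` on `supp Ω`). [cite: Luscher1983, §3] -/
theorem fpBOKernel_near_two_sided {β : ℝ} (hβ : 0 ≤ β) {Ω : LinkSpace L → ℝ} (hΩm : Measurable Ω) {CΩ : ℝ} (hCΩ : ∀ x, |Ω x| ≤ CΩ) (hΩ0 : ∀ x, 0 ≤ Ω x)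
    {W : (Site 3 L → SU2) → ℝ} (hW : Measurable W) {CW : ℝ} (hCW : ∀ g, |W g| ≤ CW) (hW0 : ∀ g, 0 ≤ W g) (u u' : GaugeConfig 3 1 SU2)
    {t σ α τu Γ R : ℝ} (ht : t ≤ 1 / 30) (hσ : σ < 2) (hS : (L : ℝ) ^ 3 * wilsonAction su2Rep u ≤ σ) (hS' : (L : ℝ) ^ 3 * wilsonAction su2Rep u' ≤ σ)
    (hα1 : α ≤ 1) (ha : ∀ k c, |vecPart (u (0, k) * (u' (0, k))⁻¹) c| ≤ α) (hw0 : ∀ k, 0 ≤ scalarPart (u (0, k) * (u' (0, k))⁻¹))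
    (hu : ∀ k, ‖vecPart (u (0, k))‖ ≤ τu)
    (hΩt : ∀ v : Edge 3 L → Fin 3 → ℝ, Ω (linkEmbed L v) ≠ 0 → (∀ (e : Edge 3 L) (c : Fin 3), |v e c| ≤ t) ∧ ‖linkEmbed L v‖ ≤ R)
    (hWc : ∀ g : Site 3 L → SU2, W g ≠ 0 → (∀ x, 0 ≤ scalarPart (g x)) ∧ (∀ x, ∑ c, vecPart (g x) c ^ 2 ≤ t ^ 2) ∧ ‖∑ x, vecPart (g x)‖ ≤ Γ) :
    Real.exp (-(β * ((Fintype.card (Edge 3 L) : ℝ) * (558 * α ^ 2 * t ^ 2 + 192 * α * t ^ 2) + 216 * α * τu * Γ) +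
        β / 2 * (100 * σ * (Fintype.card (Plaquette 3 L × Fin 3) : ℝ) * R ^ 2 + 2 * stepActionErr (L := L) t σ +
          10080 * α * (Fintype.card (Plaquette 3 L × Fin 3) : ℝ) * R ^ 2))) *
        (fpBOKernel L β Ω W u u / transferKernel su2Rep ((L : ℝ) ^ 3 * β) u u) ≤ fpBOKernel L β Ω W u u' / transferKernel su2Rep ((L : ℝ) ^ 3 * β) u u' ∧
      fpBOKernel L β Ω W u u' / transferKernel su2Rep ((L : ℝ) ^ 3 * β) u u' ≤
        Real.exp (β * ((Fintype.card (Edge 3 L) : ℝ) * (558 * α ^ 2 * t ^ 2 + 192 * α * t ^ 2) + 216 * α * τu * Γ) +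
          β / 2 * (100 * σ * (Fintype.card (Plaquette 3 L × Fin 3) : ℝ) * R ^ 2 + 2 * stepActionErr (L := L) t σ +
            10080 * α * (Fintype.card (Plaquette 3 L × Fin 3) : ℝ) * R ^ 2)) *
          (fpBOKernel L β Ω W u u / transferKernel su2Rep ((L : ℝ) ^ 3 * β) u u) := by
  have hα0 : 0 ≤ α := (abs_nonneg _).trans (ha 0 0)
  have hσ0 : 0 ≤ σ := le_trans (mul_nonneg (by positivity) (wilsonAction_su2_nonneg u)) hS
  have hN0 : (0 : ℝ) ≤ Fintype.card (Plaquette 3 L × Fin 3) := Nat.cast_nonneg _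
  refine fpBOKernel_offdiag_two_sided_cap β hΩm hCΩ hΩ0 hW hCW hW0 u u' fun v v' g hv hv' hΩv hΩv' hWg => ?_
  obtain ⟨hvt, -⟩ := hΩt v hΩv
  obtain ⟨hv't, hR⟩ := hΩt v' hΩv'
  obtain ⟨hg0, hgt, hΓ⟩ := hWc g hWg
  have h := abs_offX_le hβ u u' hv hv' ht hσ hS hS' hvt hv't hg0 hgt hΓ hα1 ha hw0 hu
  have hR2 : ‖linkEmbed L v'‖ ^ 2 ≤ R ^ 2 := pow_le_pow_left₀ (norm_nonneg _) hR 2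
  have k1 := mul_le_mul_of_nonneg_left hR2 (mul_nonneg (mul_nonneg (by norm_num : (0 : ℝ) ≤ 100) hσ0) hN0)
  have k2 := mul_le_mul_of_nonneg_left hR2 (mul_nonneg (mul_nonneg (by norm_num : (0 : ℝ) ≤ 10080) hα0) hN0)
  have hmono : β / 2 * (100 * σ * (Fintype.card (Plaquette 3 L × Fin 3) : ℝ) * ‖linkEmbed L v'‖ ^ 2 + 2 * stepActionErr (L := L) t σ +
        10080 * α * (Fintype.card (Plaquette 3 L × Fin 3) : ℝ) * ‖linkEmbed L v'‖ ^ 2) ≤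
      β / 2 * (100 * σ * (Fintype.card (Plaquette 3 L × Fin 3) : ℝ) * R ^ 2 + 2 * stepActionErr (L := L) t σ +
        10080 * α * (Fintype.card (Plaquette 3 L × Fin 3) : ℝ) * R ^ 2) :=
    mul_le_mul_of_nonneg_left (by linarith) (by linarith)
  linarith

end Summit.QuantumFields.YangMills.Theorems.FemtoTransferGap.TwoLattice.ConstTube

end
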